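import Mathlib.FieldTheory.PrimitiveElement
import Mathlib.FieldTheory.SeparablyGenerated
import Literature.FieldTheory.Regular.RacPurelyTranscendental
import Literature.FieldTheory.Regular.RegularExtension
import HarnessLib

/-!
# The relative algebraic closure in a finitely generated extension is finitely generated

Let `E/k` be a finitely generated field extension in characteristic `0`. Then the elements of
`E` algebraic over `k` form a *finite* extension `k'` of `k` (Lang, *Algebra*, VIII §4; the degree
`[k' : k]` is bounded by `[E : k(t)]` for a transcendence basis `t`, because `k` is algebraically
closed in `k(t)` so that `[k(t)(y) : k(t)] = [k(y) : k]` for `y` algebraic over `k`). We prove it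
in the form used downstream (`Literature.FieldTheory.Regular.exists_finset_isAlgClosedIn`):
there is a finite set `s` of elements of `E` algebraic over `k` such that `k(s)` is relatively
algebraically closed in `E` — the hypothesis of the regularity criterion
`Literature.FieldTheory.Regular.isDomain_tensorProduct_of_isAlgClosedIn`.

## References

* S. Lang, *Algebra*, 3rd ed., GTM 211, Springer 2002, VIII §4.
-/

open scoped IntermediateField

namespace Literature.FieldTheory.Regular

variable {k E : Type*} [Field k] [Field E] [Algebra k E]

/-- `k` is relatively algebraically closed in `k(s₀)` for an algebraically independent finite set
`s₀` (the tree's `mem_of_isAlgebraic_of_mem_adjoin_of_algebraicIndependent`, repackaged for the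
field `↥k(s₀)`). [cite: Lang2002, VIII §4] -/
theorem isAlgClosedIn_adjoin_of_algebraicIndependent [CharZero k] (s₀ : Finset E)
    (hs : AlgebraicIndependent k (Subtype.val : s₀ → E))
    (w : IntermediateField.adjoin k (↑s₀ : Set E)) (hw : IsAlgebraic k w) :
    w ∈ Set.range (algebraMap k (IntermediateField.adjoin k (↑s₀ : Set E))) := by
  haveI : CharZero E := charZero_of_injective_algebraMap (algebraMap k E).injective
  have hz : IsAlgebraic k (w : E) := hw.algebraMap (A := E)
  -- transport to the copy `⊥ ≅ k` inside `E`
  have hsB : AlgebraicIndependent (⊥ : IntermediateField k E) (Subtype.val : s₀ → E) := by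
    have := hs.ringHom_of_comp_eq ((IntermediateField.botEquiv k E).symm : k →+* (⊥ : IntermediateField k E))
      (RingHom.id E) (IntermediateField.botEquiv k E).symm.surjective Function.injective_id ?_
    · simpa using this
    · ext c
      simp [IntermediateField.botEquiv_symm]
  have hmem : (w : E) ∈ IntermediateField.adjoin (⊥ : IntermediateField k E)
      (Set.range (Subtype.val : s₀ → E)) := by
    rw [Subtype.range_coe_subtype, Finset.setOf_mem]
    have hw' : (w : E) ∈ (IntermediateField.adjoin k (↑s₀ : Set E)).toSubfield := w.2
    rw [IntermediateField.adjoin_toSubfield] at hw'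
    have hsub : Set.range (algebraMap k E) ∪ (↑s₀ : Set E) ⊆
        Set.range (algebraMap (⊥ : IntermediateField k E) E) ∪ (↑s₀ : Set E) := by
      refine Set.union_subset_union_left _ ?_
      rintro _ ⟨c, rfl⟩
      exact ⟨algebraMap k (⊥ : IntermediateField k E) c,
        (IsScalarTower.algebraMap_apply k (⊥ : IntermediateField k E) E c).symm⟩
    have := Subfield.closure_mono hsub hw'
    rw [← IntermediateField.adjoin_toSubfield] at this
    exact this
  have halg : IsAlgebraic (⊥ : IntermediateField k E) (w : E) :=
    hz.tower_top (L := (⊥ : IntermediateField k E))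
  have hwB : (w : E) ∈ (⊥ : IntermediateField k E) :=
    mem_of_isAlgebraic_of_mem_adjoin_of_algebraicIndependent (⊥ : IntermediateField k E)
      (Subtype.val : s₀ → E) hsB hmem halg
  rw [IntermediateField.mem_bot] at hwB
  obtain ⟨c, hc⟩ := hwB
  exact ⟨c, Subtype.ext hc⟩

/-- **Degree bound.** If `E` is finite over `k(s₀)` for an algebraically independent `s₀`, then
for every `y ∈ E` algebraic over `k`, `[k(y) : k] ≤ [E : k(s₀)]`: the minimal polynomial of `y`
over `k` stays irreducible over `k(s₀)` (`irreducible_map_of_isAlgClosedIn`), so it is the minimal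
polynomial over `k(s₀)`, whose degree is `[k(s₀)(y) : k(s₀)] ≤ [E : k(s₀)]`.
[cite: Lang2002, VIII §4] -/
theorem natDegree_minpoly_le_finrank [CharZero k] (s₀ : Finset E)
    (hs : AlgebraicIndependent k (Subtype.val : s₀ → E))
    [FiniteDimensional (IntermediateField.adjoin k (↑s₀ : Set E)) E] {y : E} (hy : IsAlgebraic k y) :
    (minpoly k y).natDegree ≤
      Module.finrank (IntermediateField.adjoin k (↑s₀ : Set E)) E := by
  set T := IntermediateField.adjoin k (↑s₀ : Set E) with hT
  have hyi : IsIntegral k y := hy.isIntegral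
  have hirr : Irreducible ((minpoly k y).map (algebraMap k T)) :=
    irreducible_map_of_isAlgClosedIn (isAlgClosedIn_adjoin_of_algebraicIndependent s₀ hs)
      (minpoly.monic hyi) (minpoly.irreducible hyi)
  have hmin : minpoly T y = (minpoly k y).map (algebraMap k T) :=
    (minpoly.eq_of_irreducible_of_monic hirr
      (by rw [Polynomial.aeval_map_algebraMap, minpoly.aeval]) ((minpoly.monic hyi).map _)).symm
  have hyT : IsIntegral T y := hyi.tower_top
  calc (minpoly k y).natDegree = (minpoly T y).natDegree := by
        rw [hmin, (minpoly.monic hyi).natDegree_map]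
    _ = Module.finrank T T⟮y⟯ := (IntermediateField.adjoin.finrank hyT).symm
    _ ≤ Module.finrank T E := by
        rw [← IntermediateField.finrank_top' (F := T) (E := E)]
        exact Submodule.finrank_mono (show (T⟮y⟯).toSubalgebra.toSubmodule ≤
          (⊤ : IntermediateField T E).toSubalgebra.toSubmodule from fun _ _ => trivial)

/-- **The relative algebraic closure of `k` in a finitely generated extension `E` is finitely
generated** (characteristic `0`): there is a finite set `s` of elements of `E` algebraic over `k`
such that every element of `E` algebraic over `k(s)` lies in `k(s)`, i.e. `k(s)` is relatively
algebraically closed in `E` (so `E/k(s)` is regular). Proof: degrees of finite subextensions of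
the algebraic closure of `k` in `E` are bounded by `[E : k(t)]` for a transcendence basis `t`
(`natDegree_minpoly_le_finrank` and the primitive element theorem); a finite `s` of maximal
degree works. [cite: Lang2002, VIII §4] -/
theorem exists_finset_isAlgClosedIn [CharZero k] [Algebra.EssFiniteType k E] :
    ∃ s : Finset E, (∀ x ∈ s, IsAlgebraic k x) ∧
      ∀ z : E, IsAlgebraic (IntermediateField.adjoin k (↑s : Set E)) z →
        z ∈ IntermediateField.adjoin k (↑s : Set E) := by
  classical
  haveI : PerfectField k := PerfectField.ofCharZero
  obtain ⟨s₀, hs₀, hsep⟩ := exists_isTranscendenceBasis_and_isSeparable_of_perfectField k E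
  set T := IntermediateField.adjoin k (↑s₀ : Set E) with hT
  haveI : Algebra.IsAlgebraic T E := Algebra.IsSeparable.isAlgebraic T E
  haveI : Algebra.EssFiniteType T E := Algebra.EssFiniteType.of_comp k T E
  haveI : Module.Finite T E := Algebra.finite_of_essFiniteType_of_isAlgebraic
  set d := Module.finrank T E with hd
  -- degree of a finite set of algebraic elements
  have hdeg : ∀ s : Finset E, (∀ x ∈ s, IsAlgebraic k x) →
      Module.finrank k (IntermediateField.adjoin k (↑s : Set E)) ≤ d := by
    intro s hs
    set Ks := IntermediateField.adjoin k (↑s : Set E) with hKs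
    have hint : ∀ x ∈ (↑s : Set E), IsIntegral k x := fun x hx => (hs x hx).isIntegral
    haveI : FiniteDimensional k Ks := IntermediateField.finiteDimensional_adjoin hint
    haveI : Algebra.IsAlgebraic k Ks := IntermediateField.isAlgebraic_adjoin hint
    haveI : Algebra.IsSeparable k Ks := Algebra.IsSeparable.of_integral k Ks
    obtain ⟨y, hy⟩ := Field.exists_primitive_element k Ks
    have hyi : IsIntegral k y := Algebra.IsIntegral.isIntegral y
    have h1 : Module.finrank k Ks = (minpoly k y).natDegree := by
      rw [← IntermediateField.finrank_top', ← hy, IntermediateField.adjoin.finrank hyi]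
    have h2 : minpoly k y = minpoly k (y : E) :=
      (minpoly.algebraMap_eq (algebraMap Ks E).injective y).symm
    rw [h1, h2]
    exact natDegree_minpoly_le_finrank s₀ hs₀.1 ((Algebra.IsAlgebraic.isAlgebraic y).algebraMap)
  -- a finite set of algebraic elements of maximal degree
  let P : ℕ → Prop := fun m => ∃ s : Finset E, (∀ x ∈ s, IsAlgebraic k x) ∧
    Module.finrank k (IntermediateField.adjoin k (↑s : Set E)) = m
  obtain ⟨s, hs, hsm⟩ : P (Nat.findGreatest P d) := by
    refine Nat.findGreatest_spec (m := Module.finrank k (IntermediateField.adjoin k (↑(∅ : Finset E) : Set E)))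
      (hdeg ∅ (by simp)) ⟨∅, by simp, rfl⟩
  have hmax : ∀ s' : Finset E, (∀ x ∈ s', IsAlgebraic k x) →
      Module.finrank k (IntermediateField.adjoin k (↑s' : Set E)) ≤
        Module.finrank k (IntermediateField.adjoin k (↑s : Set E)) := by
    intro s' hs'
    rw [hsm]
    exact Nat.le_findGreatest (hdeg s' hs') ⟨s', hs', rfl⟩
  refine ⟨s, hs, fun z hz => ?_⟩
  -- `z` is algebraic over `k`
  have hint : ∀ x ∈ (↑s : Set E), IsIntegral k x := fun x hx => (hs x hx).isIntegral
  haveI : Algebra.IsAlgebraic k (IntermediateField.adjoin k (↑s : Set E)) :=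
    IntermediateField.isAlgebraic_adjoin hint
  have hzk : IsAlgebraic k z :=
    (isIntegral_trans (R := k) (A := IntermediateField.adjoin k (↑s : Set E)) z hz.isIntegral).isAlgebraic
  -- adjoining `z` does not increase the (maximal) degree
  set s' : Finset E := insert z s with hs'
  have hs'alg : ∀ x ∈ s', IsAlgebraic k x := by
    intro x hx
    rcases Finset.mem_insert.1 hx with rfl | hx
    · exact hzk
    · exact hs x hx
  have hle : IntermediateField.adjoin k (↑s : Set E) ≤ IntermediateField.adjoin k (↑s' : Set E) :=
    IntermediateField.adjoin.mono k _ _ (by rw [hs', Finset.coe_insert]; exact Set.subset_insert _ _)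
  haveI : FiniteDimensional k (IntermediateField.adjoin k (↑s' : Set E)) :=
    IntermediateField.finiteDimensional_adjoin fun x hx => (hs'alg x hx).isIntegral
  have heq := IntermediateField.eq_of_le_of_finrank_le hle (hmax s' hs'alg)
  rw [heq]
  exact IntermediateField.subset_adjoin k _ (by rw [hs', Finset.coe_insert]; exact Set.mem_insert _ _)

end Literature.FieldTheory.Regular
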